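import Summits.AtomisticToContinuum.FouriersLaw.Theorems.HonestZwanzigRobinCoercivityLimitOperatorTransfer
import Summits.AtomisticToContinuum.FouriersLaw.Theorems.HonestZwanzigRobinCoercivitySymbolZeroOfPositiveMemory

/-!
# `HonestZwanzig.RobinCoercivity`, line `limit-operator-memory-form`: bulk bond-row sums from (U′) and (L)

Support file for the crux `stmt-AtomisticToContinuum-12695` (`RobinCoercivity` of route `HonestZwanzig`, sub-problem
`FouriersLaw`), line `limit-operator-memory-form`, registered LINK lemma `bulkRowSum_of_blockInputs`: the line's two
rank-2 inputs — (U′) `BlockBandDomination` (uniform off-band `ℓ¹` row tails `τ(d) → 0` of the block memory matrix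
`W_N(s)`) and (L) `BlockBulkLimit` (summable bulk Toeplitz limit `K` of `W_N(s)` at every fixed distance) — imply that
the BULK BOND-ROW SUMS `Σ_{1 ≤ j ≤ N−1} W_N(s)_{ij}` are `ε`-close to ONE constant `k = Σ'_z K(z)`, uniformly in `N`, for
all rows `i` at distance `> R(ε)` from both contacts and all small `s > 0` (the bulk clause of the route's rank-2 crux
`OrthogonalOhm` at finite `s`; it documents that the shared items (U′), (L) dominate `OrthogonalOhm`'s bulk content).

Proof (pure bookkeeping at one fixed `(N, s)`). Given `ε`, choose the window `Z` with `|Σ_{|z| ≤ Z} K(z) − k| < ε/3`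
(`tendsto_sum_Icc_symm`) and `τ(Z) < ε/3`, then the bulk depth `R_L` of (L) at accuracy `ε/(3(2Z+1))` and distance `Z`,
and put `R = R_L + Z`. For a row `i` at distance `> R` from both contacts every column of the window `|i − j| ≤ Z` is a
bond column in the `R_L`-bulk, so `|Σ_{bond j} W_{ij} − Σ_{|z| ≤ Z} K(z)| ≤ Σ_{|i−j| ≤ Z} |W_{ij} − K(i − j)| +
Σ_{|i−j| > Z} |W_{ij}| ≤ (2Z+1)·ε/(3(2Z+1)) + τ(Z)` (`ohm_row_abs_le`, re-indexing by `sum_window_offset`), whence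
`|Σ_{bond j} W_{ij} − k| < ε`.
-/

noncomputable section

open MeasureTheory Finset Matrix Filter Topology
open Literature.MathematicalPhysics.KineticTheory.HeatConduction
open Summit.AtomisticToContinuum.FouriersLaw.Theses.HonestZwanzig

namespace Summit.AtomisticToContinuum.FouriersLaw.Theorems.HonestZwanzig.Robin

/-! ### One row: window closeness plus off-window tail (pure bookkeeping on the positions `Fin (N+1)`) -/

/-- **Two-sided row bound.** A row `w` on the positions `Fin (N+1)` whose entries are `ε`-close to `K(i − j)` on the
`R`-bulk columns of the window `|i − j| ≤ Z` and whose off-window `ℓ¹` tail is `≤ τZ` has bond-column sum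
(columns `1 … N−1`) within `(2Z+1)ε + τZ` of `Σ_{|z| ≤ Z} K(z)`, provided `i` is at distance `> R + Z` from both
contacts (then every window column is a bond column in the `R`-bulk). -/
theorem ohm_row_abs_le {N Z R : ℕ} (i : Fin (N + 1)) (hi1 : R + 1 + Z ≤ i.val) (hi2 : i.val + 1 + R + Z ≤ N)
    (w : Fin (N + 1) → ℝ) (K : ℤ → ℝ) (ε τZ : ℝ)
    (hL : ∀ j : Fin (N + 1), R + 1 ≤ j.val → j.val + 1 + R ≤ N → i.val ≤ j.val + Z → j.val ≤ i.val + Z →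
      |w j - K ((i.val : ℤ) - j.val)| ≤ ε)
    (hB : ∑ j : Fin (N + 1), (if (Z : ℝ) < |(i.val : ℝ) - j.val| then |w j| else 0) ≤ τZ) :
    |(∑ j : Fin (N + 1), if 1 ≤ j.val ∧ j.val + 1 ≤ N then w j else 0) -
        ∑ z ∈ Finset.Icc (-(Z : ℤ)) Z, K z| ≤ ((2 * Z + 1 : ℕ) : ℝ) * ε + τZ := by
  -- per-column bound: window columns are bond columns and `ε`-close to `K`, the rest is absorbed by the tail
  have hterm : ∀ j : Fin (N + 1),
      |(if 1 ≤ j.val ∧ j.val + 1 ≤ N then w j else 0) -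
          (if i.val ≤ j.val + Z ∧ j.val ≤ i.val + Z then K ((i.val : ℤ) - j.val) else 0)| ≤
        (if i.val ≤ j.val + Z ∧ j.val ≤ i.val + Z then ε else 0) +
          (if (Z : ℝ) < |(i.val : ℝ) - j.val| then |w j| else 0) := by
    intro j
    have hnn : 0 ≤ (if (Z : ℝ) < |(i.val : ℝ) - j.val| then |w j| else 0) := by
      split_ifs
      · exact abs_nonneg _
      · exact le_rfl
    by_cases hw : i.val ≤ j.val + Z ∧ j.val ≤ i.val + Z
    · rw [if_pos hw, if_pos hw, if_pos (show 1 ≤ j.val ∧ j.val + 1 ≤ N by omega)]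
      have h1 := hL j (by omega) (by omega) hw.1 hw.2
      linarith
    · rw [if_neg hw, if_neg hw, if_pos (off_window_real i j hw), sub_zero, zero_add]
      split_ifs
      · exact le_rfl
      · rw [abs_zero]
        exact abs_nonneg _
  have hwinK : ∑ j : Fin (N + 1), (if i.val ≤ j.val + Z ∧ j.val ≤ i.val + Z then K ((i.val : ℤ) - j.val) else 0) =
      ∑ z ∈ Finset.Icc (-(Z : ℤ)) Z, K z := sum_window_offset i (by omega) (by omega) K
  have hwinε : ∑ j : Fin (N + 1), (if i.val ≤ j.val + Z ∧ j.val ≤ i.val + Z then ε else 0) =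
      ((2 * Z + 1 : ℕ) : ℝ) * ε := by
    rw [sum_window_offset i (by omega) (by omega) (fun _ => ε), Finset.sum_const, Int.card_Icc, nsmul_eq_mul]
    congr 1
    norm_cast
    omega
  calc |(∑ j : Fin (N + 1), if 1 ≤ j.val ∧ j.val + 1 ≤ N then w j else 0) - ∑ z ∈ Finset.Icc (-(Z : ℤ)) Z, K z|
      = |∑ j : Fin (N + 1), ((if 1 ≤ j.val ∧ j.val + 1 ≤ N then w j else 0) -
          (if i.val ≤ j.val + Z ∧ j.val ≤ i.val + Z then K ((i.val : ℤ) - j.val) else 0))| := by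
        rw [Finset.sum_sub_distrib, hwinK]
    _ ≤ ∑ j : Fin (N + 1), |(if 1 ≤ j.val ∧ j.val + 1 ≤ N then w j else 0) -
          (if i.val ≤ j.val + Z ∧ j.val ≤ i.val + Z then K ((i.val : ℤ) - j.val) else 0)| :=
        Finset.abs_sum_le_sum_abs _ _
    _ ≤ ∑ j : Fin (N + 1), ((if i.val ≤ j.val + Z ∧ j.val ≤ i.val + Z then ε else 0) +
          (if (Z : ℝ) < |(i.val : ℝ) - j.val| then |w j| else 0)) := Finset.sum_le_sum fun j _ => hterm j
    _ = ((2 * Z + 1 : ℕ) : ℝ) * ε +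
          ∑ j : Fin (N + 1), (if (Z : ℝ) < |(i.val : ℝ) - j.val| then |w j| else 0) := by
        rw [Finset.sum_add_distrib, hwinε]
    _ ≤ ((2 * Z + 1 : ℕ) : ℝ) * ε + τZ := by linarith

/-! ### The link lemma -/

/-- **Bulk bond-row sums of the block memory matrix from (U′) and (L)** (registered link lemma of line
`limit-operator-memory-form`, crux `RobinCoercivity`; the bulk clause of the route's rank-2 crux `OrthogonalOhm` at
finite `s`). Under (U′) `BlockBandDomination` and (L) `BlockBulkLimit`, for `pinnedChain ω₂ lam β γ` (all `> 0`) and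
`T > 0` there is ONE constant `k` (namely `Σ'_z K_∞(z)`) such that for every `ε > 0` there is a bulk depth `R` with:
for all `N ≥ 2`, all small `s > 0` and the line's gadgets `lap, e, G, schur, g, W` with their defining equations, every
row `i` of `W_N(s)` at distance `> R` from both contacts has bond-column sum `Σ_{1 ≤ j ≤ N−1} W_N(s)_{ij}` within `ε`
of `k`. -/
theorem bulkRowSum_of_blockInputs (hU : BlockBandDomination) (hL : BlockBulkLimit) :
    ∀ ω₂ lam β γ : ℝ, 0 < ω₂ → 0 < lam → 0 < β → 0 < γ → ∀ T : ℝ, 0 < T → ∃ k : ℝ, ∀ ε : ℝ, 0 < ε → ∃ R : ℕ,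
    ∀ N : ℕ, 2 ≤ N → ∃ s₀ : ℝ, 0 < s₀ ∧
    ∀ (lap : ℝ → (PhaseSpace N → ℝ) → (PhaseSpace N → ℝ) → ℝ) (e : Fin N → PhaseSpace N → ℝ)
      (G : ℝ → Matrix (Fin N) (Fin N) ℝ) (schur : ℝ → (PhaseSpace N → ℝ) → (PhaseSpace N → ℝ) → ℝ)
      (g : Fin (N + 1) → PhaseSpace N → ℝ) (W : ℝ → Fin (N + 1) → Fin (N + 1) → ℝ),
    (∀ s f₁ f₂, lap s f₁ f₂ = ∫ t in Set.Ioi (0 : ℝ), Real.exp (-(s * t)) *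
      ((∫ z, f₁ z * (∫ y, f₂ y ∂((pinnedChain ω₂ lam β γ).transitionKernel N T T t.toNNReal z))
          ∂(pinnedChain ω₂ lam β γ).gibbsMeasure N T) -
        (∫ z, f₁ z ∂(pinnedChain ω₂ lam β γ).gibbsMeasure N T) *
          (∫ z, f₂ z ∂(pinnedChain ω₂ lam β γ).gibbsMeasure N T))) →
    (∀ x z, e x z = z.2 x ^ 2 / 2 + (pinnedChain ω₂ lam β γ).U (z.1 x) +
      ∑ j : Fin N, ((if j.val = x.val + 1 then (pinnedChain ω₂ lam β γ).V (z.1 j - z.1 x) / 2 else 0) +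
        (if x.val = j.val + 1 then (pinnedChain ω₂ lam β γ).V (z.1 x - z.1 j) / 2 else 0))) →
    (∀ s, G s = Matrix.of fun x y => lap s (e x) (e y)) →
    (∀ s f₁ f₂, schur s f₁ f₂ = lap s f₁ f₂ - ∑ x, ∑ y, lap s f₁ (e x) * (G s)⁻¹ x y * lap s (e y) f₂) →
    (∀ i z, g i z = (∑ b : Fin N, if b.val + 1 = i.val then (pinnedChain ω₂ lam β γ).bondCurrent N b z else 0) +
      (∑ x : Fin N, if (i.val = 0 ∧ x.val = 0) ∨ (i.val = N ∧ x.val + 1 = N) then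
        (pinnedChain ω₂ lam β γ).γ * (T - z.2 x ^ 2) else 0)) →
    (∀ s i j, W s i j = (if i = j ∧ (i.val = 0 ∨ i.val = N) then (pinnedChain ω₂ lam β γ).γ * T ^ 2 else 0) -
      schur s (fun z => g i (z.1, -z.2)) (g j)) →
    ∀ s : ℝ, 0 < s → s < s₀ → ∀ i : Fin (N + 1), R + 1 ≤ i.val → i.val + 1 + R ≤ N →
    |(∑ j : Fin (N + 1), if 1 ≤ j.val ∧ j.val + 1 ≤ N then W s i j else 0) - k| ≤ ε := by
  unfold BlockBandDomination at hU
  unfold BlockBulkLimit at hL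
  intro ω₂ lam β γ hω hl hβ hγ T hT
  obtain ⟨τ, hτ, hUN⟩ := hU ω₂ lam β γ hω hl hβ hγ T hT
  obtain ⟨K, hKs, hLN⟩ := hL ω₂ lam β γ hω hl hβ hγ T hT
  refine ⟨∑' z, K z, fun ε hε => ?_⟩
  -- the window `Z`: symmetric partial sum `ε/3`-close to `Σ' K` and band tail `τ Z < ε/3`
  have h1 : ∀ᶠ Z : ℕ in atTop, dist (∑ z ∈ Finset.Icc (-(Z : ℤ)) Z, K z) (∑' z, K z) < ε / 3 :=
    Metric.tendsto_nhds.1 (tendsto_sum_Icc_symm K hKs) (ε / 3) (by positivity)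
  have h2 : ∀ᶠ Z : ℕ in atTop, dist (τ Z) 0 < ε / 3 := Metric.tendsto_nhds.1 hτ (ε / 3) (by positivity)
  obtain ⟨Z, hZ1, hZ2⟩ := (h1.and h2).exists
  rw [Real.dist_eq] at hZ1
  rw [Real.dist_eq, sub_zero] at hZ2
  have hcpos : (0 : ℝ) < ((2 * Z + 1 : ℕ) : ℝ) := by positivity
  -- the bulk depth of (L) at accuracy `ε / (3(2Z+1))` and distance `Z`
  obtain ⟨R, hR⟩ := hLN (ε / (3 * ((2 * Z + 1 : ℕ) : ℝ))) (by positivity) Z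
  refine ⟨R + Z, fun N hN => ?_⟩
  obtain ⟨s₁, hs₁, hB⟩ := hUN N hN
  obtain ⟨s₂, hs₂, hC⟩ := hR N hN
  refine ⟨min s₁ s₂, lt_min hs₁ hs₂, ?_⟩
  intro lap e G schur g W hlap he hG hschur hg hW s hs hss i hi1 hi2
  have hss1 : s < s₁ := lt_of_lt_of_le hss (min_le_left _ _)
  have hss2 : s < s₂ := lt_of_lt_of_le hss (min_le_right _ _)
  have hB' := hB lap e G schur g W hlap he hG hschur hg hW s hs hss1 i Z
  have hC' := hC lap e G schur g W hlap he hG hschur hg hW s hs hss2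
  have hrow := ohm_row_abs_le i (by omega) (by omega) (W s i) K (ε / (3 * ((2 * Z + 1 : ℕ) : ℝ))) (τ Z)
    (fun j hj1 hj2 hj3 hj4 => hC' i j (by omega) (by omega) hj1 hj2 hj3 hj4) hB'
  have h3 : ((2 * Z + 1 : ℕ) : ℝ) * (ε / (3 * ((2 * Z + 1 : ℕ) : ℝ))) = ε / 3 := by
    field_simp
  rw [h3] at hrow
  have hk := abs_sub_le (∑ j : Fin (N + 1), if 1 ≤ j.val ∧ j.val + 1 ≤ N then W s i j else 0)
    (∑ z ∈ Finset.Icc (-(Z : ℤ)) Z, K z) (∑' z, K z)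
  have hτle : τ Z < ε / 3 := (le_abs_self _).trans_lt hZ2
  linarith

end Summit.AtomisticToContinuum.FouriersLaw.Theorems.HonestZwanzig.Robin

end
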